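import Literature.Analysis.FluidPDE.PineauVicolWeightedIdentity
import HarnessLib

/-!
# Route CorkscrewDynamo · crux `CorkscrewProfile` (stmt-NavierStokesRegularity-11282) — Gaussian × polynomial growth
# is integrable (tool stub W2)

Line `registered` (= `Cruxes/CorkscrewProfile/Lines/birth.lean`), lead c6 (2026-08-17), tool stub W2
`stub_gaussianPolyIntegrable` of the Gaussian angular-momentum block (wave 2).

On a finite-dimensional real inner product space `E` (Lebesgue measure `volume`, Mathlib's
`measureSpaceOfInnerProductSpace`), an a.e.-strongly measurable `f : E → F'` into a real normed space with the
polynomial bound `‖f y‖ ≤ C (1 + ‖y‖)ᴺ` has `G • f ∈ L¹(E)` for the Gaussian weight `G(y) = e^{−‖y‖²/4}`: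
`‖G(y) • f(y)‖ = G(y) ‖f(y)‖ ≤ C (1 + ‖y‖)ᴺ e^{−‖y‖²/4}`, the majorant being integrable by the tree's
`PineauVicol2026.integrable_one_add_norm_pow_mul_exp_neg_mul_sq` (`(1 + ‖v‖)ᴺ e^{−c‖v‖²} ∈ L¹`, here `c = ¼`), and
`Integrable.mono'` with the a.e.-strong measurability of `G • f` (`G` continuous) concludes. A real-valued companion
with `*` in place of `•` is recorded for the scalar integrands `G div F`, `G ⟪y, F⟫` of the block.
All statements are folklore real analysis (domination by an integrable majorant).
-/

noncomputable section

open MeasureTheory Filter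
open Literature.Analysis.FluidPDE

namespace Summit.NavierStokesRegularity.NavierStokesRegularity.Theorems.CorkscrewProfile.Birth

set_option linter.dupNamespace false

variable {E : Type*} [NormedAddCommGroup E] [InnerProductSpace ℝ E] [FiniteDimensional ℝ E]

/-- The Gaussian-weighted polynomial majorant `C (1 + ‖y‖)ᴺ e^{−‖y‖²/4}` is integrable on a finite-dimensional
inner product space (`PineauVicol2026.integrable_one_add_norm_pow_mul_exp_neg_mul_sq` with `c = ¼`, rewritten
`−¼‖y‖² = −‖y‖²/4`). [folklore] -/
theorem integrable_const_mul_one_add_norm_pow_mul_gaussianWeight [MeasurableSpace E] [BorelSpace E]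
    (C : ℝ) (N : ℕ) :
    MeasureTheory.Integrable (fun y : E => C * ((1 + ‖y‖) ^ N * Real.exp (-‖y‖ ^ 2 / 4))) := by
  have hg := (PineauVicol2026.integrable_one_add_norm_pow_mul_exp_neg_mul_sq (E := E) (c := 1 / 4)
    (by norm_num) N).const_mul C
  refine hg.congr (Eventually.of_forall fun y => ?_)
  have he : Real.exp (-(1 / 4) * ‖y‖ ^ 2) = Real.exp (-‖y‖ ^ 2 / 4) := by
    congr 1
    ring
  simp only [he]

/-- **Tool stub W2 `stub_gaussianPolyIntegrable` — Gaussian times polynomial growth is integrable.** On a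
finite-dimensional real inner product space, an a.e.-strongly measurable `f` with `‖f y‖ ≤ C (1 + ‖y‖)ᴺ` has
`G • f ∈ L¹` for `G(y) = e^{−‖y‖²/4}`: `‖G • f‖ = G ‖f‖ ≤ C (1 + ‖y‖)ᴺ e^{−‖y‖²/4}`, an integrable majorant
(`integrable_const_mul_one_add_norm_pow_mul_gaussianWeight`), and `G • f` is a.e.-strongly measurable since `G` is
continuous; `Integrable.mono'`. [folklore] -/
theorem stub_gaussianPolyIntegrable [MeasurableSpace E] [BorelSpace E]
    {F' : Type*} [NormedAddCommGroup F'] [NormedSpace ℝ F'] {f : E → F'} {C : ℝ} {N : ℕ}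
    (hf : MeasureTheory.AEStronglyMeasurable f MeasureTheory.volume)
    (hb : ∀ y, ‖f y‖ ≤ C * (1 + ‖y‖) ^ N) :
    MeasureTheory.Integrable (fun y => Real.exp (-‖y‖ ^ 2 / 4) • f y) := by
  have hG : Continuous fun y : E => Real.exp (-‖y‖ ^ 2 / 4) := by fun_prop
  refine (integrable_const_mul_one_add_norm_pow_mul_gaussianWeight (E := E) C N).mono'
    (hG.aestronglyMeasurable.smul hf) (Eventually.of_forall fun y => ?_)
  rw [norm_smul, Real.norm_of_nonneg (Real.exp_pos _).le]
  calc Real.exp (-‖y‖ ^ 2 / 4) * ‖f y‖ ≤ Real.exp (-‖y‖ ^ 2 / 4) * (C * (1 + ‖y‖) ^ N) :=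
        mul_le_mul_of_nonneg_left (hb y) (Real.exp_pos _).le
    _ = C * ((1 + ‖y‖) ^ N * Real.exp (-‖y‖ ^ 2 / 4)) := by ring

/-- Real-valued companion of `stub_gaussianPolyIntegrable`: an a.e.-strongly measurable `f : E → ℝ` with
`|f y| ≤ C (1 + ‖y‖)ᴺ` has `y ↦ e^{−‖y‖²/4} f(y)` integrable. [folklore] -/
theorem gaussianPolyIntegrable_mul [MeasurableSpace E] [BorelSpace E] {f : E → ℝ} {C : ℝ} {N : ℕ}
    (hf : MeasureTheory.AEStronglyMeasurable f MeasureTheory.volume)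
    (hb : ∀ y, ‖f y‖ ≤ C * (1 + ‖y‖) ^ N) :
    MeasureTheory.Integrable (fun y => Real.exp (-‖y‖ ^ 2 / 4) * f y) :=
  stub_gaussianPolyIntegrable hf hb

/-- Continuous companion of `stub_gaussianPolyIntegrable`: a continuous `f` with `‖f y‖ ≤ C (1 + ‖y‖)ᴺ` has
`e^{−‖y‖²/4} • f ∈ L¹`. [folklore] -/
theorem gaussianPolyIntegrable_of_continuous [MeasurableSpace E] [BorelSpace E]
    {F' : Type*} [NormedAddCommGroup F'] [NormedSpace ℝ F'] {f : E → F'} {C : ℝ} {N : ℕ}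
    (hf : Continuous f) (hb : ∀ y, ‖f y‖ ≤ C * (1 + ‖y‖) ^ N) :
    MeasureTheory.Integrable (fun y => Real.exp (-‖y‖ ^ 2 / 4) • f y) :=
  stub_gaussianPolyIntegrable hf.aestronglyMeasurable hb

end Summit.NavierStokesRegularity.NavierStokesRegularity.Theorems.CorkscrewProfile.Birth
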